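import Summits.NavierStokesRegularity.NavierStokesRegularity.Theorems.FlatGaugeAtSingularity.Negative.FlatGaugeAtSingularityFalseOfFatVortexLines

/-!
# `FlatGaugeAtSingularity` (stmt-NavierStokesRegularity-1252): the registered stubs are sandwiched like the crux

Negative-side bookkeeping for the crux `FlatGaugeAtSingularity` (FG) of route `FlatSwirlGauge`, by the lead (c4)
of its only line `registered` (= `Cruxes/FlatGaugeAtSingularity/Lines/birth.lean`, cut FG ⟺ K ∧ D with
K = `stub_vortexChartAtSingularity` — a kinematic vortex chart `Literature.Analysis.FluidPDE.IsVortexChartOn`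
at every singular point — and D = `stub_driftSizeRegauge` — re-gauge a chart to drift-size transport defect
`Literature.Analysis.FluidPDE.HasDriftSizeDefectOn`). The stub statements are written out INLINE (no local
definitions: this is a proof file), over `EuclideanSpace ℝ (Fin 3)`.

What is recorded here, all by plain logic from the landed vocabulary and the two companion Negative files:

* `flatGaugeAtSingularity_iff_chartStub_and_defectStub` — the cut of the line is EXACT at the level of the
  stub statements: FG ⟺ K ∧ D (`hasFlatSwirlGauge_iff_chart_and_defect`, `isVortexChartOn_of_gauge`,
  `hasDriftSizeDefectOn_of_gauge`). Hence every line for FG proves K and D under some name.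
* `chartStub_of_noBlowup`, `defectStub_of_noBlowup` — "no blow-up in the Leray–Hopf classical class"
  (verbatim the antecedent of the route's `NoBlowupToClay`, i.e. the shared target `NoBlowup`,
  stmt-NavierStokesRegularity-0054) implies K and D VACUOUSLY (via `flatGaugeAtSingularity_of_noBlowup`).
* `exists_blowup_of_not_chartStub`, `exists_chart_blowup_of_not_defectStub` — a refutation of K exhibits a
  finite-time blow-up of the class; a refutation of D exhibits one whose singular point moreover CARRIES a
  kinematic vortex chart and no flat swirl gauge (an "integrable" singularity). Neither stub is refutable short
  of a negative answer to the Millennium problem.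
* `chartStub_false_of_fatVortexLines` — the hypothesis `FatVortexLinesAtSingularity` of
  `flatGaugeAtSingularity_false_of_fatVortexLines` (a blow-up with a fat frozen-time vortex line inside every
  backward cylinder at its singular point) already kills the KINEMATIC stub K.
* `defectStub_of_forall_fatVortexLines` — and its universal form (every singular point of every solution of the
  class is of that kind) implies D VACUOUSLY: D is blind to the obstruction that kills K.

So K is implied by `NoBlowup` and refuted by one fat frozen vortex line at a singularity; D is implied by
`NoBlowup` and by universal fat vortex lines alike. This is the kernel-checked content of the lead's verdict
`blocked-on: stmt-NavierStokesRegularity-0054` (crux workfile `BLOCKED-c4.md`).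
-/

-- the problem namespace `Summit.NavierStokesRegularity.NavierStokesRegularity` repeats the summit name by design (D-0017)
set_option linter.dupNamespace false

noncomputable section

open Set MeasureTheory Metric Function Filter
open scoped RealInnerProductSpace ENNReal Topology
open Literature.Analysis.FluidPDE
open Summit.NavierStokesRegularity.NavierStokesRegularity.Theses.FlatSwirlGauge

namespace Summit.NavierStokesRegularity.NavierStokesRegularity.Theorems.FlatGaugeAtSingularity.Negative

/-! ### The cut FG ⟺ K ∧ D is exact at the level of the stub statements -/

/-- **The cut of line `registered` is exact.** `FlatGaugeAtSingularity` is EQUIVALENT to the conjunction of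
the statements of its two registered stubs, K (`stub_vortexChartAtSingularity`: a kinematic vortex chart at
every singular point) and D (`stub_driftSizeRegauge`: given some chart at a singular point, a chart with
drift-size transport defect), both written out inline. (→): a flat swirl gauge is a chart
(`isVortexChartOn_of_gauge`) with drift-size defect (`hasDriftSizeDefectOn_of_gauge`, `C₁ := C₀ ≥ 0`);
(←): K gives a chart, D re-gauges it, `hasFlatSwirlGauge_iff_chart_and_defect` rebuilds the drift. So every
conceivable line for FG proves K and D under some name. [folklore] -/
theorem flatGaugeAtSingularity_iff_chartStub_and_defectStub :
    FlatGaugeAtSingularity ↔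
      ((∀ (ν T : ℝ), 0 < ν → 0 < T →
        ∀ (u : ℝ → EuclideanSpace ℝ (Fin 3) → EuclideanSpace ℝ (Fin 3))
          (p : ℝ → EuclideanSpace ℝ (Fin 3) → ℝ),
          IsClassicalNSSolutionOn (Set.Ico 0 T) ν 0 u p → IsLerayHopfOn T ν 0 (u 0) u →
          HasRapidSpatialDecay (u 0) →
          ∀ x₀ : EuclideanSpace ℝ (Fin 3),
            ¬ (∃ r : ℝ, 0 < r ∧ ∃ K : ℝ, ∀ t ∈ Set.Ioo (T - r ^ 2) T, 0 ≤ t →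
              ∀ x ∈ Metric.ball x₀ r, ‖u t x‖ ≤ K) →
            ∃ (ρ C₀ M : ℝ) (α : ℝ → EuclideanSpace ℝ (Fin 3) → ℝ)
              (d : ℝ → EuclideanSpace ℝ (Fin 3) → ℝ), IsVortexChartOn u T x₀ ρ C₀ M α d) ∧
      (∀ (ν T : ℝ), 0 < ν → 0 < T →
        ∀ (u : ℝ → EuclideanSpace ℝ (Fin 3) → EuclideanSpace ℝ (Fin 3))
          (p : ℝ → EuclideanSpace ℝ (Fin 3) → ℝ),
          IsClassicalNSSolutionOn (Set.Ico 0 T) ν 0 u p → IsLerayHopfOn T ν 0 (u 0) u →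
          HasRapidSpatialDecay (u 0) →
          ∀ x₀ : EuclideanSpace ℝ (Fin 3),
            ¬ (∃ r : ℝ, 0 < r ∧ ∃ K : ℝ, ∀ t ∈ Set.Ioo (T - r ^ 2) T, 0 ≤ t →
              ∀ x ∈ Metric.ball x₀ r, ‖u t x‖ ≤ K) →
            (∃ (ρ C₀ M : ℝ) (α : ℝ → EuclideanSpace ℝ (Fin 3) → ℝ)
              (d : ℝ → EuclideanSpace ℝ (Fin 3) → ℝ), IsVortexChartOn u T x₀ ρ C₀ M α d) →
            ∃ (ρ C₀ M C₁ : ℝ) (α : ℝ → EuclideanSpace ℝ (Fin 3) → ℝ)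
              (d : ℝ → EuclideanSpace ℝ (Fin 3) → ℝ),
              IsVortexChartOn u T x₀ ρ C₀ M α d ∧ 0 ≤ C₁ ∧ HasDriftSizeDefectOn ν u T x₀ ρ C₁ α d)) := by
  constructor
  · intro hFG
    refine ⟨fun ν T hν hT u p hcl hLH hdec x₀ hsing => ?_,
      fun ν T hν hT u p hcl hLH hdec x₀ hsing _ => ?_⟩
    · obtain ⟨ρ, C₀, M, α, b, d, hg⟩ :=
        (hasFlatSwirlGauge_iff ν u T x₀).2 (hFG ν T hν hT u p hcl hLH hdec x₀ hsing)
      exact ⟨ρ, C₀, M, α, d, isVortexChartOn_of_gauge hg⟩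
    · exact (hasFlatSwirlGauge_iff_chart_and_defect hν).1
        ((hasFlatSwirlGauge_iff ν u T x₀).2 (hFG ν T hν hT u p hcl hLH hdec x₀ hsing))
  · rintro ⟨hK, hD⟩ ν T hν hT u p hcl hLH hdec x₀ hsing
    exact (hasFlatSwirlGauge_iff ν u T x₀).1 ((hasFlatSwirlGauge_iff_chart_and_defect hν).2
      (hD ν T hν hT u p hcl hLH hdec x₀ hsing (hK ν T hν hT u p hcl hLH hdec x₀ hsing)))

/-! ### Both stubs are implied by "no blow-up" -/

/-- **K follows from "no blow-up".** If every Leray–Hopf classical solution on `ℝ³ × [0, T)` from a rapidly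
decaying datum extends smoothly past `T` (verbatim the antecedent of the route's `NoBlowupToClay` = the shared
target `NoBlowup`, stmt-NavierStokesRegularity-0054), then the statement of `stub_vortexChartAtSingularity`
holds — vacuously, through `flatGaugeAtSingularity_of_noBlowup` and the exact cut. [folklore] -/
theorem chartStub_of_noBlowup
    (hNB : ∀ (ν T : ℝ), 0 < ν → 0 < T →
      ∀ (u : ℝ → EuclideanSpace ℝ (Fin 3) → EuclideanSpace ℝ (Fin 3))
        (p : ℝ → EuclideanSpace ℝ (Fin 3) → ℝ),
        IsClassicalNSSolutionOn (Set.Ico 0 T) ν 0 u p → IsLerayHopfOn T ν 0 (u 0) u →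
        HasRapidSpatialDecay (u 0) → HasSmoothExtensionPast ν 0 u T) :
    ∀ (ν T : ℝ), 0 < ν → 0 < T →
      ∀ (u : ℝ → EuclideanSpace ℝ (Fin 3) → EuclideanSpace ℝ (Fin 3))
        (p : ℝ → EuclideanSpace ℝ (Fin 3) → ℝ),
        IsClassicalNSSolutionOn (Set.Ico 0 T) ν 0 u p → IsLerayHopfOn T ν 0 (u 0) u →
        HasRapidSpatialDecay (u 0) →
        ∀ x₀ : EuclideanSpace ℝ (Fin 3),
          ¬ (∃ r : ℝ, 0 < r ∧ ∃ K : ℝ, ∀ t ∈ Set.Ioo (T - r ^ 2) T, 0 ≤ t →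
            ∀ x ∈ Metric.ball x₀ r, ‖u t x‖ ≤ K) →
          ∃ (ρ C₀ M : ℝ) (α : ℝ → EuclideanSpace ℝ (Fin 3) → ℝ)
            (d : ℝ → EuclideanSpace ℝ (Fin 3) → ℝ), IsVortexChartOn u T x₀ ρ C₀ M α d :=
  (flatGaugeAtSingularity_iff_chartStub_and_defectStub.1 (flatGaugeAtSingularity_of_noBlowup hNB)).1

/-- **D follows from "no blow-up"** as well (same antecedent; vacuous through
`flatGaugeAtSingularity_of_noBlowup` and the exact cut). [folklore] -/
theorem defectStub_of_noBlowup
    (hNB : ∀ (ν T : ℝ), 0 < ν → 0 < T →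
      ∀ (u : ℝ → EuclideanSpace ℝ (Fin 3) → EuclideanSpace ℝ (Fin 3))
        (p : ℝ → EuclideanSpace ℝ (Fin 3) → ℝ),
        IsClassicalNSSolutionOn (Set.Ico 0 T) ν 0 u p → IsLerayHopfOn T ν 0 (u 0) u →
        HasRapidSpatialDecay (u 0) → HasSmoothExtensionPast ν 0 u T) :
    ∀ (ν T : ℝ), 0 < ν → 0 < T →
      ∀ (u : ℝ → EuclideanSpace ℝ (Fin 3) → EuclideanSpace ℝ (Fin 3))
        (p : ℝ → EuclideanSpace ℝ (Fin 3) → ℝ),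
        IsClassicalNSSolutionOn (Set.Ico 0 T) ν 0 u p → IsLerayHopfOn T ν 0 (u 0) u →
        HasRapidSpatialDecay (u 0) →
        ∀ x₀ : EuclideanSpace ℝ (Fin 3),
          ¬ (∃ r : ℝ, 0 < r ∧ ∃ K : ℝ, ∀ t ∈ Set.Ioo (T - r ^ 2) T, 0 ≤ t →
            ∀ x ∈ Metric.ball x₀ r, ‖u t x‖ ≤ K) →
          (∃ (ρ C₀ M : ℝ) (α : ℝ → EuclideanSpace ℝ (Fin 3) → ℝ)
            (d : ℝ → EuclideanSpace ℝ (Fin 3) → ℝ), IsVortexChartOn u T x₀ ρ C₀ M α d) →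
          ∃ (ρ C₀ M C₁ : ℝ) (α : ℝ → EuclideanSpace ℝ (Fin 3) → ℝ)
            (d : ℝ → EuclideanSpace ℝ (Fin 3) → ℝ),
            IsVortexChartOn u T x₀ ρ C₀ M α d ∧ 0 ≤ C₁ ∧ HasDriftSizeDefectOn ν u T x₀ ρ C₁ α d :=
  (flatGaugeAtSingularity_iff_chartStub_and_defectStub.1 (flatGaugeAtSingularity_of_noBlowup hNB)).2

/-! ### A refutation of either stub exhibits a blow-up -/

/-- **`¬K` exhibits a finite-time blow-up**: a Leray–Hopf classical solution of the class with no smooth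
extension past its time `T` (contrapositive of `chartStub_of_noBlowup`). So the kinematic stub is irrefutable
short of a negative answer to the Millennium problem. [folklore] -/
theorem exists_blowup_of_not_chartStub
    (h : ¬ ∀ (ν T : ℝ), 0 < ν → 0 < T →
      ∀ (u : ℝ → EuclideanSpace ℝ (Fin 3) → EuclideanSpace ℝ (Fin 3))
        (p : ℝ → EuclideanSpace ℝ (Fin 3) → ℝ),
        IsClassicalNSSolutionOn (Set.Ico 0 T) ν 0 u p → IsLerayHopfOn T ν 0 (u 0) u →
        HasRapidSpatialDecay (u 0) →
        ∀ x₀ : EuclideanSpace ℝ (Fin 3),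
          ¬ (∃ r : ℝ, 0 < r ∧ ∃ K : ℝ, ∀ t ∈ Set.Ioo (T - r ^ 2) T, 0 ≤ t →
            ∀ x ∈ Metric.ball x₀ r, ‖u t x‖ ≤ K) →
          ∃ (ρ C₀ M : ℝ) (α : ℝ → EuclideanSpace ℝ (Fin 3) → ℝ)
            (d : ℝ → EuclideanSpace ℝ (Fin 3) → ℝ), IsVortexChartOn u T x₀ ρ C₀ M α d) :
    ∃ (ν T : ℝ) (u : ℝ → EuclideanSpace ℝ (Fin 3) → EuclideanSpace ℝ (Fin 3))
      (p : ℝ → EuclideanSpace ℝ (Fin 3) → ℝ), 0 < ν ∧ 0 < T ∧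
      IsClassicalNSSolutionOn (Set.Ico 0 T) ν 0 u p ∧ IsLerayHopfOn T ν 0 (u 0) u ∧
      HasRapidSpatialDecay (u 0) ∧ ¬ HasSmoothExtensionPast ν 0 u T := by
  by_contra hne
  push Not at hne
  exact h (chartStub_of_noBlowup fun ν T hν hT u p hcl hLH hdec => hne ν T u p hν hT hcl hLH hdec)

/-- **`¬D` exhibits an INTEGRABLE blow-up**: a singular point of a solution of the class that CARRIES a
kinematic vortex chart on some backward cylinder and admits no flat swirl gauge (plain logic with the lossless
seam `hasFlatSwirlGauge_iff_chart_and_defect`). In particular it exhibits a blow-up, so D too is irrefutable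
short of a negative answer to the Millennium problem; and a blow-up of the fat-vortex-line kind
(`defectStub_of_forall_fatVortexLines`) is of no use against D. [folklore] -/
theorem exists_chart_blowup_of_not_defectStub
    (h : ¬ ∀ (ν T : ℝ), 0 < ν → 0 < T →
      ∀ (u : ℝ → EuclideanSpace ℝ (Fin 3) → EuclideanSpace ℝ (Fin 3))
        (p : ℝ → EuclideanSpace ℝ (Fin 3) → ℝ),
        IsClassicalNSSolutionOn (Set.Ico 0 T) ν 0 u p → IsLerayHopfOn T ν 0 (u 0) u →
        HasRapidSpatialDecay (u 0) →
        ∀ x₀ : EuclideanSpace ℝ (Fin 3),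
          ¬ (∃ r : ℝ, 0 < r ∧ ∃ K : ℝ, ∀ t ∈ Set.Ioo (T - r ^ 2) T, 0 ≤ t →
            ∀ x ∈ Metric.ball x₀ r, ‖u t x‖ ≤ K) →
          (∃ (ρ C₀ M : ℝ) (α : ℝ → EuclideanSpace ℝ (Fin 3) → ℝ)
            (d : ℝ → EuclideanSpace ℝ (Fin 3) → ℝ), IsVortexChartOn u T x₀ ρ C₀ M α d) →
          ∃ (ρ C₀ M C₁ : ℝ) (α : ℝ → EuclideanSpace ℝ (Fin 3) → ℝ)
            (d : ℝ → EuclideanSpace ℝ (Fin 3) → ℝ),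
            IsVortexChartOn u T x₀ ρ C₀ M α d ∧ 0 ≤ C₁ ∧ HasDriftSizeDefectOn ν u T x₀ ρ C₁ α d) :
    ∃ (ν T : ℝ) (u : ℝ → EuclideanSpace ℝ (Fin 3) → EuclideanSpace ℝ (Fin 3))
      (p : ℝ → EuclideanSpace ℝ (Fin 3) → ℝ) (x₀ : EuclideanSpace ℝ (Fin 3)), 0 < ν ∧ 0 < T ∧
      IsClassicalNSSolutionOn (Set.Ico 0 T) ν 0 u p ∧ IsLerayHopfOn T ν 0 (u 0) u ∧
      HasRapidSpatialDecay (u 0) ∧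
      ¬ (∃ r : ℝ, 0 < r ∧ ∃ K : ℝ, ∀ t ∈ Set.Ioo (T - r ^ 2) T, 0 ≤ t →
          ∀ x ∈ Metric.ball x₀ r, ‖u t x‖ ≤ K) ∧
      (∃ (ρ C₀ M : ℝ) (α : ℝ → EuclideanSpace ℝ (Fin 3) → ℝ)
          (d : ℝ → EuclideanSpace ℝ (Fin 3) → ℝ), IsVortexChartOn u T x₀ ρ C₀ M α d) ∧
      ¬ HasFlatSwirlGauge ν u T x₀ := by
  by_contra hne
  apply h
  intro ν T hν hT u p hcl hLH hdec x₀ hsing hK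
  by_contra hcon
  exact hne ⟨ν, T, u, p, x₀, hν, hT, hcl, hLH, hdec, hsing, hK,
    fun hg => hcon ((hasFlatSwirlGauge_iff_chart_and_defect hν).1 hg)⟩

/-! ### Fat vortex lines at a singularity: fatal for K, idle for D -/

/-- **K is false modulo `FatVortexLinesAtSingularity`.** The inline hypothesis of
`flatGaugeAtSingularity_false_of_fatVortexLines` (some Leray–Hopf classical blow-up at `(T, x₀)` with, inside
every backward cylinder `Q_ρ(T, x₀)`, a time slice carrying a vortex line that stays in `B_ρ(x₀)` and whose
orbit closure has positive volume on the support of the vorticity) already refutes the KINEMATIC stub: the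
chart it would provide at that singular point is killed by `not_isVortexChartOn_of_fat_vortexLine` before any
dynamics is used. Not constructible today (it contains a blow-up): a negative-MODULO lemma. [folklore] -/
theorem chartStub_false_of_fatVortexLines
    (H : ∃ (ν T : ℝ) (u : ℝ → EuclideanSpace ℝ (Fin 3) → EuclideanSpace ℝ (Fin 3))
      (p : ℝ → EuclideanSpace ℝ (Fin 3) → ℝ) (x₀ : EuclideanSpace ℝ (Fin 3)), 0 < ν ∧ 0 < T ∧
      IsClassicalNSSolutionOn (Set.Ico 0 T) ν 0 u p ∧ IsLerayHopfOn T ν 0 (u 0) u ∧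
      HasRapidSpatialDecay (u 0) ∧
      ¬ (∃ r : ℝ, 0 < r ∧ ∃ K : ℝ, ∀ t ∈ Set.Ioo (T - r ^ 2) T, 0 ≤ t →
          ∀ x ∈ Metric.ball x₀ r, ‖u t x‖ ≤ K) ∧
      ∀ ρ : ℝ, 0 < ρ → ρ ^ 2 < T → ∃ t ∈ Ioo (T - ρ ^ 2) T,
        ∃ γ : ℝ → EuclideanSpace ℝ (Fin 3), (∀ s, HasDerivAt γ (curl (u t) (γ s)) s) ∧
        (∀ s, γ s ∈ ball x₀ ρ) ∧
        volume (closure (range γ) ∩ ball x₀ ρ ∩ {x | curl (u t) x ≠ 0}) ≠ 0) :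
    ¬ ∀ (ν T : ℝ), 0 < ν → 0 < T →
      ∀ (u : ℝ → EuclideanSpace ℝ (Fin 3) → EuclideanSpace ℝ (Fin 3))
        (p : ℝ → EuclideanSpace ℝ (Fin 3) → ℝ),
        IsClassicalNSSolutionOn (Set.Ico 0 T) ν 0 u p → IsLerayHopfOn T ν 0 (u 0) u →
        HasRapidSpatialDecay (u 0) →
        ∀ x₀ : EuclideanSpace ℝ (Fin 3),
          ¬ (∃ r : ℝ, 0 < r ∧ ∃ K : ℝ, ∀ t ∈ Set.Ioo (T - r ^ 2) T, 0 ≤ t →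
            ∀ x ∈ Metric.ball x₀ r, ‖u t x‖ ≤ K) →
          ∃ (ρ C₀ M : ℝ) (α : ℝ → EuclideanSpace ℝ (Fin 3) → ℝ)
            (d : ℝ → EuclideanSpace ℝ (Fin 3) → ℝ), IsVortexChartOn u T x₀ ρ C₀ M α d := by
  intro hK
  obtain ⟨ν, T, u, p, x₀, hν, hT, hcl, hLH, hdec, hsing, hfvl⟩ := H
  obtain ⟨ρ, C₀, M, α, d, hchart⟩ := hK ν T hν hT u p hcl hLH hdec x₀ hsing
  obtain ⟨t, ht, γ, hγ, hγB, hfat⟩ := hfvl ρ hchart.1 hchart.2.1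
  exact not_isVortexChartOn_of_fat_vortexLine ht hγ hγB hfat hchart

/-- **D is implied VACUOUSLY by universal fat vortex lines.** If EVERY singular point of every solution of the
class has, inside every backward cylinder, a time slice with a fat frozen vortex line (the universal form of
`FatVortexLinesAtSingularity`, which refutes K and FG), then the chart hypothesis of `stub_driftSizeRegauge` is
never met (`not_isVortexChartOn_of_fat_vortexLine`) and D holds vacuously. Together with
`chartStub_false_of_fatVortexLines`: the Lagrangian-chaos obstruction decides K and says nothing about D; D is
decided only at blow-ups with integrable frozen vorticity (`exists_chart_blowup_of_not_defectStub`). [folklore] -/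
theorem defectStub_of_forall_fatVortexLines
    (hU : ∀ (ν T : ℝ) (u : ℝ → EuclideanSpace ℝ (Fin 3) → EuclideanSpace ℝ (Fin 3))
      (p : ℝ → EuclideanSpace ℝ (Fin 3) → ℝ) (x₀ : EuclideanSpace ℝ (Fin 3)), 0 < ν → 0 < T →
      IsClassicalNSSolutionOn (Set.Ico 0 T) ν 0 u p → IsLerayHopfOn T ν 0 (u 0) u →
      HasRapidSpatialDecay (u 0) →
      ¬ (∃ r : ℝ, 0 < r ∧ ∃ K : ℝ, ∀ t ∈ Set.Ioo (T - r ^ 2) T, 0 ≤ t →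
          ∀ x ∈ Metric.ball x₀ r, ‖u t x‖ ≤ K) →
      ∀ ρ : ℝ, 0 < ρ → ρ ^ 2 < T → ∃ t ∈ Ioo (T - ρ ^ 2) T,
        ∃ γ : ℝ → EuclideanSpace ℝ (Fin 3), (∀ s, HasDerivAt γ (curl (u t) (γ s)) s) ∧
        (∀ s, γ s ∈ ball x₀ ρ) ∧
        volume (closure (range γ) ∩ ball x₀ ρ ∩ {x | curl (u t) x ≠ 0}) ≠ 0) :
    ∀ (ν T : ℝ), 0 < ν → 0 < T →
      ∀ (u : ℝ → EuclideanSpace ℝ (Fin 3) → EuclideanSpace ℝ (Fin 3))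
        (p : ℝ → EuclideanSpace ℝ (Fin 3) → ℝ),
        IsClassicalNSSolutionOn (Set.Ico 0 T) ν 0 u p → IsLerayHopfOn T ν 0 (u 0) u →
        HasRapidSpatialDecay (u 0) →
        ∀ x₀ : EuclideanSpace ℝ (Fin 3),
          ¬ (∃ r : ℝ, 0 < r ∧ ∃ K : ℝ, ∀ t ∈ Set.Ioo (T - r ^ 2) T, 0 ≤ t →
            ∀ x ∈ Metric.ball x₀ r, ‖u t x‖ ≤ K) →
          (∃ (ρ C₀ M : ℝ) (α : ℝ → EuclideanSpace ℝ (Fin 3) → ℝ)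
            (d : ℝ → EuclideanSpace ℝ (Fin 3) → ℝ), IsVortexChartOn u T x₀ ρ C₀ M α d) →
          ∃ (ρ C₀ M C₁ : ℝ) (α : ℝ → EuclideanSpace ℝ (Fin 3) → ℝ)
            (d : ℝ → EuclideanSpace ℝ (Fin 3) → ℝ),
            IsVortexChartOn u T x₀ ρ C₀ M α d ∧ 0 ≤ C₁ ∧ HasDriftSizeDefectOn ν u T x₀ ρ C₁ α d := by
  intro ν T hν hT u p hcl hLH hdec x₀ hsing hK
  obtain ⟨ρ, C₀, M, α, d, hchart⟩ := hK
  obtain ⟨t, ht, γ, hγ, hγB, hfat⟩ := hU ν T u p x₀ hν hT hcl hLH hdec hsing ρ hchart.1 hchart.2.1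
  exact absurd hchart (not_isVortexChartOn_of_fat_vortexLine ht hγ hγB hfat)

end Summit.NavierStokesRegularity.NavierStokesRegularity.Theorems.FlatGaugeAtSingularity.Negative

end
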